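import Literature.MathematicalPhysics.QuantumLattice.LatticeGaugeDLR
import Literature.Probability.LatticeModels.LatticeLaplacianZd
import HarnessLib

/-!
# Stub `stub_hodge` of line `Sketch` (crux `stmt-QuantumFields-8760`)

Route `EquipartitionCriticality` of `YangMills`, crux item `stmt-QuantumFields-8760`
(`Summit.QuantumFields.YangMills.Theses.EquipartitionCriticality.EquipartitionPinsProbe`), line
`Sketch`, STUB H of the lead's skeleton.

What is proved: the **Hodge identity `d d* + d* d = -Δ` on `2`-cochains of `ℤ^d`**, in the form
the skeleton consumes it. A `2`-cochain `c : ZdPlaquette 4 → ℝ` (a real number on every plaquette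
`(x; i < j)`) that is *co-closed*,
`(d*c)(x, i) = ∑_{j > i} (c(x; i, j) − c(x − eⱼ; i, j)) + ∑_{j < i} (c(x − eⱼ; j, i) − c(x; j, i)) = 0`
on every edge `(x, i)`, and *closed*, `∂ᵢ c_{jk} − ∂ⱼ c_{ik} + ∂ₖ c_{ij} = 0` on every `3`-cell
`(x; i < j < k)` (`∂ᵢ` the forward difference along `eᵢ`), has harmonic plane components:
`latticeLaplacianZd (c(·; i, j)) = 0` for every `i < j`.

Proof (dimension-free, `Hodge.laplacian_eq_zero`): pass to the antisymmetric extension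
`C y a b` (`= c(y; a, b)` if `a < b`, `= −c(y; b, a)` if `b < a`, `= 0` if `a = b`). Co-closedness
reads `∑ₖ (C y l k − C (y − eₖ) l k) = 0` for all `y, l`, and closedness gives the vanishing of the
cube coboundary `D(y; i, j, k) := ∂ᵢ C_{jk} − ∂ⱼ C_{ik} + ∂ₖ C_{ij}` for the fixed `i < j` and *every*
`k` (it is alternating in its indices, so the cases `k = i`, `k = j` are automatic and the others are
the closedness hypothesis at the sorted triple, up to sign). The purely algebraic identity
`∑ₖ (D(x; i, j, k) − D(x − eₖ; i, j, k)) = (d*C)ⱼ(x + eᵢ) − (d*C)ⱼ(x) − (d*C)ᵢ(x + eⱼ) + (d*C)ᵢ(x)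
  + Δ C_{ij}(x)`
(all mixed second differences cancel) then yields `Δ C_{ij}(x) = 0`. No facts beyond the
definition `latticeLaplacianZd_def` are used.
-/

noncomputable section

open Literature.MathematicalPhysics.QuantumLattice Literature.Probability.LatticeModels

namespace Summit.QuantumFields.YangMills.Theorems.EquipartitionPinsProbe

namespace Hodge

variable {d : ℕ}

/-- **The Hodge identity on `2`-cochains of `ℤ^d`, vanishing form.** Let `C : ℤ^d → (Fin d)² → ℝ`
be any family of functions (in the application, the antisymmetric extension of a `2`-cochain) and
fix two directions `i, j`. If `C` is co-closed, `∑ₖ (C y l k − C (y − eₖ) l k) = 0` for all `y, l`,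
and its cube coboundary in the directions `(i, j, k)`,
`(C (y + eᵢ) j k − C y j k) − (C (y + eⱼ) i k − C y i k) + (C (y + eₖ) i j − C y i j)`, vanishes
for every base point `y` and every `k`, then the component `y ↦ C y i j` is harmonic:
`latticeLaplacianZd (C · i j) x = 0`. This is `(d d* + d* d) C = -Δ C` read componentwise: summing
the difference of the coboundaries at `x` and `x − eₖ` over `k`, the mixed second differences are
exactly the four codifferential terms at `(x + eᵢ, j), (x, j), (x + eⱼ, i), (x, i)` and what is left
is `Δ C_{ij}(x)`. -/
theorem laplacian_eq_zero (C : Site d → Fin d → Fin d → ℝ) (i j : Fin d)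
    (hcod : ∀ (y : Site d) (l : Fin d), ∑ k, (C y l k - C (y - Pi.single k 1) l k) = 0)
    (hcl : ∀ (y : Site d) (k : Fin d),
      (C (y + Pi.single i 1) j k - C y j k) - (C (y + Pi.single j 1) i k - C y i k) +
        (C (y + Pi.single k 1) i j - C y i j) = 0)
    (x : Site d) : latticeLaplacianZd (fun y => C y i j) x = 0 := by
  have hA := hcod (x + Pi.single i 1) j
  have hB := hcod x j
  have hC := hcod (x + Pi.single j 1) i
  have hD := hcod x i
  have hE : ∑ k, ((C (x + Pi.single i 1) j k - C x j k) - (C (x + Pi.single j 1) i k - C x i k) +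
      (C (x + Pi.single k 1) i j - C x i j)) = 0 :=
    Finset.sum_eq_zero fun k _ => hcl x k
  have hF : ∑ k, ((C (x + Pi.single i 1 - Pi.single k 1) j k - C (x - Pi.single k 1) j k) -
      (C (x + Pi.single j 1 - Pi.single k 1) i k - C (x - Pi.single k 1) i k) +
      (C x i j - C (x - Pi.single k 1) i j)) = 0 := by
    refine Finset.sum_eq_zero fun k _ => ?_
    have h := hcl (x - Pi.single k 1) k
    rw [sub_add_cancel] at h
    simpa only [sub_add_eq_add_sub] using h
  simp only [Finset.sum_add_distrib, Finset.sum_sub_distrib, Finset.sum_const, Finset.card_univ,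
    Fintype.card_fin, nsmul_eq_mul] at hA hB hC hD hE hF
  simp only [latticeLaplacianZd_def, Finset.sum_add_distrib]
  linear_combination hE - hF - hA + hB + hC - hD

end Hodge

/-- STUB H — **Hodge identity on 2-cochains of `ℤ⁴`**: a 2-cochain `c` that is co-closed
(`(d*c)(x,i) = ∑_{j>i} (c(x;i,j) − c(x−eⱼ;i,j)) + ∑_{j<i} (c(x−eⱼ;j,i) − c(x;j,i)) = 0` on every
edge) and closed (`∂ᵢc_{jk} − ∂ⱼc_{ik} + ∂ₖc_{ij} = 0` on every `3`-cell `(x; i < j < k)`) has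
harmonic plane components: `Δ c(·; i, j) = 0` (`dd* + d*d = −Δ` componentwise,
`Hodge.laplacian_eq_zero` applied to the antisymmetric extension of `c`). -/
theorem stub_hodge :
    ∀ (c : Literature.MathematicalPhysics.QuantumLattice.ZdPlaquette 4 → ℝ),
      (∀ (x : Literature.Probability.LatticeModels.Site 4) (i : Fin 4),
        (∑ j : Fin 4,
          if hij : i < j then (c (x, ⟨(i, j), hij⟩) - c (x - Pi.single j 1, ⟨(i, j), hij⟩))
          else if hji : j < i then (c (x - Pi.single j 1, ⟨(j, i), hji⟩) - c (x, ⟨(j, i), hji⟩))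
          else 0) = 0) →
      (∀ (x : Literature.Probability.LatticeModels.Site 4) (i j k : Fin 4) (hij : i < j) (hjk : j < k),
        (c (x + Pi.single i 1, ⟨(j, k), hjk⟩) - c (x, ⟨(j, k), hjk⟩)) -
          (c (x + Pi.single j 1, ⟨(i, k), hij.trans hjk⟩) - c (x, ⟨(i, k), hij.trans hjk⟩)) +
          (c (x + Pi.single k 1, ⟨(i, j), hij⟩) - c (x, ⟨(i, j), hij⟩)) = 0) →
      ∀ (i j : Fin 4) (hij : i < j) (x : Literature.Probability.LatticeModels.Site 4),
        Literature.Probability.LatticeModels.latticeLaplacianZd (fun y => c (y, ⟨(i, j), hij⟩)) x = 0 := by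
  intro c h1 h2 i j hij x
  have key := Hodge.laplacian_eq_zero
    (fun (y : Site 4) (a b : Fin 4) =>
      if h : a < b then c (y, ⟨(a, b), h⟩) else if h' : b < a then -c (y, ⟨(b, a), h'⟩) else 0)
    i j ?_ ?_ x
  · simpa only [dif_pos hij] using key
  · -- co-closedness of the antisymmetric extension = hypothesis 1, summand by summand
    intro y l
    refine (Finset.sum_congr rfl fun k _ => ?_).trans (h1 y l)
    split_ifs <;> ring
  · -- closedness for the fixed `i < j` and every third direction `k`
    intro y k
    rcases lt_trichotomy j k with hjk | rfl | hkj
    · simp only [dif_pos hjk, dif_pos (hij.trans hjk), dif_pos hij]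
      exact h2 y i j k hij hjk
    · simp only [dif_neg (lt_irrefl j), dif_pos hij]
      ring
    · rcases lt_trichotomy i k with hik | rfl | hki
      · simp only [dif_neg (lt_asymm hkj), dif_pos hkj, dif_pos hik, dif_pos hij]
        linear_combination (-1 : ℝ) * h2 y i k j hik hkj
      · simp only [dif_neg (lt_asymm hij), dif_neg (lt_irrefl i), dif_pos hij]
        ring
      · simp only [dif_neg (lt_asymm hkj), dif_pos hkj, dif_neg (lt_asymm hki), dif_pos hki,
          dif_pos hij]
        linear_combination h2 y k i j hki hij

end Summit.QuantumFields.YangMills.Theorems.EquipartitionPinsProbe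

end
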